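import Summits.CriticalPhenomena.PercolationContinuityZ3.Theorems.Transplant.FKConnectivityAllQApexHubCyl
import HarnessLib

/-!
# Connectivity correlation inequalities for `φ_{w,q}`, every `q > 0` — the HUB INEQUALITY AT AN APEX, file 3:
# CLOSED FORMS for the masses of the connection events at one apex (the level-one dictionary)

Support file (`--supports stmt-CriticalPhenomena-4575`), census seat `prim-bschramm-census` (gen 22) of the post-continuity
programme; builds on p205010 (kernel theorem, internal audit signed; external expert review pending).  No definitions, no named
facts, no sorries; standard axioms.  Continues `…ApexHubCyl.lean`.

For an apex `y` over `(u, v)` (`a = s(u,y)`, `b = s(y,v)`, `w° = w[a↦0][b↦0]`, `K' = {u ↔ v avoiding a, b}`, `A° = S°(K')`,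
`B° = S°(K'ᶜ)`, `r = q⁻¹`, leaf-type weights `N = (1−w a)(1−w b)`, `U = (w a)(1−w b)r`, `V' = (1−w a)(w b)r`, `W = (w a)(w b)r`)
the table lemma gives the masses of the events generated by `{u ↔ v}`, `{u ↔ y}`, `{v ↔ y}`:
`Z = W(A°+B°+(r−1)B°) + (U+V'+N)(A°+B°)`, `S(u↔v) = W(A°+B°+(r−1)B°) + (U+V'+N)A°`, `S(u↔y) = W(…) + U(A°+B°) + V'A°`,
`S(v↔y) = W(…) + V'(A°+B°) + UA°`, `S(u↔y ∨ v↔y) = W(…) + (U+V')(A°+B°)`, `S((u↔y ∨ v↔y) ∧ u↮v) = (U+V')B°`,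
`S(u↔v ∧ v↔y) = S(u↔v ∧ u↔y) = W(…) + (U+V')A°` (`apexForm_*`).  These are the level-one inputs of the two- and three-apex hub
inequalities (`…ApexHubTwo/Three.lean`), where `w` is the vector with the other apexes' pairs already deleted.
[cite: AyyerLinussonRavichandran2025, §7 eq. (13)–(15) (p. 22)] [cite: Grimmett2006, Thm. (3.1)(a) (p. 37); §1.4 eq. (1.20) (p. 15)]
-/

noncomputable section

namespace Summit.CriticalPhenomena.PercolationContinuityZ3.Theorems

namespace FK

open MeasureTheory Set Literature.Probability.LatticeModels Literature.Probability.Percolation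
open Literature.Probability.Percolation.DecisionTree (ind ind_of_mem ind_of_not_mem ind_nonneg)
open Literature.Probability.Percolation.TwoAvoidanceSets (ind_mul_ind)
open scoped Classical symmDiff

variable {V : Type*} [Fintype V]

section Forms

variable (w : Sym2 V → unitInterval) {q : ℝ} (hq : q ≠ 0) {u v y : V} (hyu : y ≠ u) (hyv : y ≠ v) (huv : u ≠ v)
  (hw : ∀ e : Sym2 V, y ∈ e → ((w e : unitInterval) : ℝ) ≠ 0 → u ∈ e ∨ v ∈ e)

/-! ### Small facts used by every form -/

omit [Fintype V] in
/-- `univ` is insensitive to any pair. [folklore] -/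
theorem univ_insens (e : Sym2 V) (ω : BondConfig V) :
    ω ∆ {e} ∈ (Set.univ : Set (BondConfig V)) ↔ ω ∈ (Set.univ : Set (BondConfig V)) := by
  simp only [Set.mem_univ]

omit [Fintype V] in
/-- `∅` is insensitive to any pair. [folklore] -/
theorem empty_insens (e : Sym2 V) (ω : BondConfig V) :
    ω ∆ {e} ∈ (∅ : Set (BondConfig V)) ↔ ω ∈ (∅ : Set (BondConfig V)) := by
  simp only [Set.mem_empty_iff_false]

omit [Fintype V] in
/-- An open pair joins its endpoints. [folklore] -/
theorem mem_openConn_of_mem {ω : BondConfig V} {x z : V} (hxz : x ≠ z) (h : s(x, z) ∈ ω) :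
    ω ∈ (openConn x z : Set (BondConfig V)) :=
  (mem_openConn_iff' x z ω).2 ((openGraph_adj ω x z).2 ⟨h, hxz⟩).reachable

omit [Fintype V] in
/-- An open pair joins its endpoints (reversed pair). [folklore] -/
theorem mem_openConn_of_mem' {ω : BondConfig V} {x z : V} (hxz : x ≠ z) (h : s(z, x) ∈ ω) :
    ω ∈ (openConn x z : Set (BondConfig V)) :=
  mem_openConn_of_mem hxz (by rw [Sym2.eq_swap]; exact h)

include hyu hyv hw in
/-- Almost surely the open pairs at the apex `y` lie in `{uy, yv}`. [cite: Grimmett2006, §1.4 eq. (1.20) (p. 15)] -/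
theorem apex_ae {ω : BondConfig V} (hω : rcWeightW w q ∅ ω ≠ 0) : ∀ e ∈ ω, y ∈ e → e = s(u, y) ∨ e = s(y, v) :=
  apex_of_rcWeightW_ne_zero w q hyu hyv hw hω

/-! ### The level-one dictionary -/

omit [Fintype V] in
/-- The open path `u – y – v`. [folklore] -/
theorem path_uv {ω : BondConfig V} (hyu : y ≠ u) (hyv : y ≠ v) (ha : s(u, y) ∈ ω) (hb : s(y, v) ∈ ω) :
    ω ∈ (openConn u v : Set (BondConfig V)) :=
  (mem_openConn_iff' u v ω).2
    (((openGraph_adj ω u y).2 ⟨ha, hyu.symm⟩).reachable.trans ((openGraph_adj ω y v).2 ⟨hb, hyv⟩).reachable)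

include hyu hyv huv hw hq in
/-- `Z_w = S_w(univ)`: table `(univ, univ, univ, univ)`. [cite: Grimmett2006, Thm. (3.1)(a) (p. 37); §1.4 eq. (1.20) (p. 15)] -/
theorem apexForm_univ :
    ∑ ω : BondConfig V, rcWeightW w q ∅ ω * ind (Set.univ : Set (BondConfig V)) ω =
      ((w s(u, y) : unitInterval) : ℝ) * ((w s(y, v) : unitInterval) : ℝ) * q⁻¹ * (∑ ω : BondConfig V, rcWeightW (Function.update (Function.update w s(u, y) 0) s(y, v) 0) q ∅ ω * ind Set.univ ω + (q⁻¹ - 1) * ∑ ω : BondConfig V, rcWeightW (Function.update (Function.update w s(u, y) 0) s(y, v) 0) q ∅ ω * ind {ω : BondConfig V | ω \ {s(u, y), s(y, v)} ∈ (openConn u v : Set (BondConfig V))}ᶜ ω) +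
        ((w s(u, y) : unitInterval) : ℝ) * (1 - ((w s(y, v) : unitInterval) : ℝ)) * q⁻¹ * ∑ ω : BondConfig V, rcWeightW (Function.update (Function.update w s(u, y) 0) s(y, v) 0) q ∅ ω * ind Set.univ ω +
        (1 - ((w s(u, y) : unitInterval) : ℝ)) * ((w s(y, v) : unitInterval) : ℝ) * q⁻¹ * ∑ ω : BondConfig V, rcWeightW (Function.update (Function.update w s(u, y) 0) s(y, v) 0) q ∅ ω * ind Set.univ ω +
        (1 - ((w s(u, y) : unitInterval) : ℝ)) * (1 - ((w s(y, v) : unitInterval) : ℝ)) * ∑ ω : BondConfig V, rcWeightW (Function.update (Function.update w s(u, y) 0) s(y, v) 0) q ∅ ω * ind Set.univ ω := by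
  have h := apex_mass_table w hq hyu hyv huv hw (Set.univ : Set (BondConfig V)) Set.univ Set.univ Set.univ Set.univ
    (fun _ _ _ _ => Iff.rfl)
    (fun _ _ _ _ => Iff.rfl)
    (fun _ _ _ _ => Iff.rfl)
    (fun _ _ _ _ => Iff.rfl)
    (univ_insens _) (univ_insens _) (univ_insens _) (univ_insens _)
  rw [Set.univ_inter] at h
  linear_combination h

include hyu hyv huv hw hq in
/-- `S_w(u ↔ v)`: table `(univ, K', K', K')`. [cite: Grimmett2006, Thm. (3.1)(a) (p. 37); §1.4 eq. (1.20) (p. 15)] -/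
theorem apexForm_uv :
    ∑ ω : BondConfig V, rcWeightW w q ∅ ω * ind (openConn u v : Set (BondConfig V)) ω =
      ((w s(u, y) : unitInterval) : ℝ) * ((w s(y, v) : unitInterval) : ℝ) * q⁻¹ * (∑ ω : BondConfig V, rcWeightW (Function.update (Function.update w s(u, y) 0) s(y, v) 0) q ∅ ω * ind Set.univ ω + (q⁻¹ - 1) * ∑ ω : BondConfig V, rcWeightW (Function.update (Function.update w s(u, y) 0) s(y, v) 0) q ∅ ω * ind {ω : BondConfig V | ω \ {s(u, y), s(y, v)} ∈ (openConn u v : Set (BondConfig V))}ᶜ ω) +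
        ((w s(u, y) : unitInterval) : ℝ) * (1 - ((w s(y, v) : unitInterval) : ℝ)) * q⁻¹ * ∑ ω : BondConfig V, rcWeightW (Function.update (Function.update w s(u, y) 0) s(y, v) 0) q ∅ ω * ind {ω : BondConfig V | ω \ {s(u, y), s(y, v)} ∈ (openConn u v : Set (BondConfig V))} ω +
        (1 - ((w s(u, y) : unitInterval) : ℝ)) * ((w s(y, v) : unitInterval) : ℝ) * q⁻¹ * ∑ ω : BondConfig V, rcWeightW (Function.update (Function.update w s(u, y) 0) s(y, v) 0) q ∅ ω * ind {ω : BondConfig V | ω \ {s(u, y), s(y, v)} ∈ (openConn u v : Set (BondConfig V))} ω +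
        (1 - ((w s(u, y) : unitInterval) : ℝ)) * (1 - ((w s(y, v) : unitInterval) : ℝ)) * ∑ ω : BondConfig V, rcWeightW (Function.update (Function.update w s(u, y) 0) s(y, v) 0) q ∅ ω * ind {ω : BondConfig V | ω \ {s(u, y), s(y, v)} ∈ (openConn u v : Set (BondConfig V))} ω := by
  have h := apex_mass_table w hq hyu hyv huv hw (openConn u v : Set (BondConfig V)) Set.univ {ω : BondConfig V | ω \ {s(u, y), s(y, v)} ∈ (openConn u v : Set (BondConfig V))} {ω : BondConfig V | ω \ {s(u, y), s(y, v)} ∈ (openConn u v : Set (BondConfig V))} {ω : BondConfig V | ω \ {s(u, y), s(y, v)} ∈ (openConn u v : Set (BondConfig V))}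
    (fun ω _ ha hb => iff_of_true (path_uv hyu hyv ha hb) (Set.mem_univ _))
    (fun ω hω hb _ => by
      rw [mem_openConn_iff', reachable_uv_apex_iff hyu hyv (apex_ae w hyu hyv hw hω), Set.mem_setOf_eq, mem_openConn_iff']
      exact ⟨fun h => h.elim id fun h' => absurd h'.2 hb, fun h => Or.inl h⟩)
    (fun ω hω ha _ => by
      rw [mem_openConn_iff', reachable_uv_apex_iff hyu hyv (apex_ae w hyu hyv hw hω), Set.mem_setOf_eq, mem_openConn_iff']
      exact ⟨fun h => h.elim id fun h' => absurd h'.1 ha, fun h => Or.inl h⟩)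
    (fun ω hω ha _ => by
      rw [mem_openConn_iff', reachable_uv_apex_iff hyu hyv (apex_ae w hyu hyv hw hω), Set.mem_setOf_eq, mem_openConn_iff']
      exact ⟨fun h => h.elim id fun h' => absurd h'.1 ha, fun h => Or.inl h⟩)
    (univ_insens _) (univ_insens _) (apexAvoid_insens u v y (Or.inl rfl)) (apexAvoid_insens u v y (Or.inr rfl))
  rw [Set.univ_inter] at h
  linear_combination h

include hyu hyv huv hw hq in
/-- `S_w(u ↔ y)`: table `(univ, univ, K', ∅)`. [cite: Grimmett2006, Thm. (3.1)(a) (p. 37); §1.4 eq. (1.20) (p. 15)] -/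
theorem apexForm_uy :
    ∑ ω : BondConfig V, rcWeightW w q ∅ ω * ind (openConn u y : Set (BondConfig V)) ω =
      ((w s(u, y) : unitInterval) : ℝ) * ((w s(y, v) : unitInterval) : ℝ) * q⁻¹ * (∑ ω : BondConfig V, rcWeightW (Function.update (Function.update w s(u, y) 0) s(y, v) 0) q ∅ ω * ind Set.univ ω + (q⁻¹ - 1) * ∑ ω : BondConfig V, rcWeightW (Function.update (Function.update w s(u, y) 0) s(y, v) 0) q ∅ ω * ind {ω : BondConfig V | ω \ {s(u, y), s(y, v)} ∈ (openConn u v : Set (BondConfig V))}ᶜ ω) +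
        ((w s(u, y) : unitInterval) : ℝ) * (1 - ((w s(y, v) : unitInterval) : ℝ)) * q⁻¹ * ∑ ω : BondConfig V, rcWeightW (Function.update (Function.update w s(u, y) 0) s(y, v) 0) q ∅ ω * ind Set.univ ω +
        (1 - ((w s(u, y) : unitInterval) : ℝ)) * ((w s(y, v) : unitInterval) : ℝ) * q⁻¹ * ∑ ω : BondConfig V, rcWeightW (Function.update (Function.update w s(u, y) 0) s(y, v) 0) q ∅ ω * ind {ω : BondConfig V | ω \ {s(u, y), s(y, v)} ∈ (openConn u v : Set (BondConfig V))} ω := by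
  have h := apex_mass_table w hq hyu hyv huv hw (openConn u y : Set (BondConfig V)) Set.univ Set.univ {ω : BondConfig V | ω \ {s(u, y), s(y, v)} ∈ (openConn u v : Set (BondConfig V))} ∅
    (fun ω _ ha _ => iff_of_true (mem_openConn_of_mem hyu.symm ha) (Set.mem_univ _))
    (fun ω _ _ ha => iff_of_true (mem_openConn_of_mem hyu.symm ha) (Set.mem_univ _))
    (fun ω hω ha hb => by
      rw [mem_openConn_iff', reachable_ux_apex_iff hyu hyv (apex_ae w hyu hyv hw hω), Set.mem_setOf_eq, mem_openConn_iff']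
      exact ⟨fun h => h.elim (fun h' => absurd h' ha) fun h' => h'.2, fun h => Or.inr ⟨hb, h⟩⟩)
    (fun ω hω ha hb => by
      rw [mem_openConn_iff', reachable_ux_apex_iff hyu hyv (apex_ae w hyu hyv hw hω)]
      exact ⟨fun h => h.elim (fun h' => absurd h' ha) fun h' => absurd h'.1 hb, fun h => absurd h (Set.notMem_empty ω)⟩)
    (univ_insens _) (univ_insens _) (univ_insens _) (apexAvoid_insens u v y (Or.inr rfl))
  rw [Set.univ_inter, sum_rcWeightW_ind_empty] at h
  linear_combination h

include hyu hyv huv hw hq in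
/-- `S_w(v ↔ y)`: table `(univ, K', univ, ∅)`. [cite: Grimmett2006, Thm. (3.1)(a) (p. 37); §1.4 eq. (1.20) (p. 15)] -/
theorem apexForm_vy :
    ∑ ω : BondConfig V, rcWeightW w q ∅ ω * ind (openConn v y : Set (BondConfig V)) ω =
      ((w s(u, y) : unitInterval) : ℝ) * ((w s(y, v) : unitInterval) : ℝ) * q⁻¹ * (∑ ω : BondConfig V, rcWeightW (Function.update (Function.update w s(u, y) 0) s(y, v) 0) q ∅ ω * ind Set.univ ω + (q⁻¹ - 1) * ∑ ω : BondConfig V, rcWeightW (Function.update (Function.update w s(u, y) 0) s(y, v) 0) q ∅ ω * ind {ω : BondConfig V | ω \ {s(u, y), s(y, v)} ∈ (openConn u v : Set (BondConfig V))}ᶜ ω) +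
        ((w s(u, y) : unitInterval) : ℝ) * (1 - ((w s(y, v) : unitInterval) : ℝ)) * q⁻¹ * ∑ ω : BondConfig V, rcWeightW (Function.update (Function.update w s(u, y) 0) s(y, v) 0) q ∅ ω * ind {ω : BondConfig V | ω \ {s(u, y), s(y, v)} ∈ (openConn u v : Set (BondConfig V))} ω +
        (1 - ((w s(u, y) : unitInterval) : ℝ)) * ((w s(y, v) : unitInterval) : ℝ) * q⁻¹ * ∑ ω : BondConfig V, rcWeightW (Function.update (Function.update w s(u, y) 0) s(y, v) 0) q ∅ ω * ind Set.univ ω := by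
  have h := apex_mass_table w hq hyu hyv huv hw (openConn v y : Set (BondConfig V)) Set.univ {ω : BondConfig V | ω \ {s(u, y), s(y, v)} ∈ (openConn u v : Set (BondConfig V))} Set.univ ∅
    (fun ω _ _ hb => iff_of_true (mem_openConn_of_mem' hyv.symm hb) (Set.mem_univ _))
    (fun ω hω hb ha => by
      rw [mem_openConn_iff', reachable_vx_apex_iff hyu hyv (apex_ae w hyu hyv hw hω), Set.mem_setOf_eq, mem_openConn_iff']
      exact ⟨fun h => h.elim (fun h' => absurd h' hb) fun h' => h'.2, fun h => Or.inr ⟨ha, h⟩⟩)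
    (fun ω _ _ hb => iff_of_true (mem_openConn_of_mem' hyv.symm hb) (Set.mem_univ _))
    (fun ω hω ha hb => by
      rw [mem_openConn_iff', reachable_vx_apex_iff hyu hyv (apex_ae w hyu hyv hw hω)]
      exact ⟨fun h => h.elim (fun h' => absurd h' hb) fun h' => absurd h'.1 ha, fun h => absurd h (Set.notMem_empty ω)⟩)
    (univ_insens _) (univ_insens _) (apexAvoid_insens u v y (Or.inl rfl)) (univ_insens _)
  rw [Set.univ_inter, sum_rcWeightW_ind_empty] at h
  linear_combination h

include hyu hyv huv hw hq in
/-- `S_w(u ↔ y ∨ v ↔ y)`: table `(univ, univ, univ, ∅)`. [cite: Grimmett2006, Thm. (3.1)(a) (p. 37); §1.4 eq. (1.20) (p. 15)] -/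
theorem apexForm_att :
    ∑ ω : BondConfig V, rcWeightW w q ∅ ω * ind ((openConn u y : Set (BondConfig V)) ∪ openConn v y) ω =
      ((w s(u, y) : unitInterval) : ℝ) * ((w s(y, v) : unitInterval) : ℝ) * q⁻¹ * (∑ ω : BondConfig V, rcWeightW (Function.update (Function.update w s(u, y) 0) s(y, v) 0) q ∅ ω * ind Set.univ ω + (q⁻¹ - 1) * ∑ ω : BondConfig V, rcWeightW (Function.update (Function.update w s(u, y) 0) s(y, v) 0) q ∅ ω * ind {ω : BondConfig V | ω \ {s(u, y), s(y, v)} ∈ (openConn u v : Set (BondConfig V))}ᶜ ω) +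
        ((w s(u, y) : unitInterval) : ℝ) * (1 - ((w s(y, v) : unitInterval) : ℝ)) * q⁻¹ * ∑ ω : BondConfig V, rcWeightW (Function.update (Function.update w s(u, y) 0) s(y, v) 0) q ∅ ω * ind Set.univ ω +
        (1 - ((w s(u, y) : unitInterval) : ℝ)) * ((w s(y, v) : unitInterval) : ℝ) * q⁻¹ * ∑ ω : BondConfig V, rcWeightW (Function.update (Function.update w s(u, y) 0) s(y, v) 0) q ∅ ω * ind Set.univ ω := by
  have h := apex_mass_table w hq hyu hyv huv hw ((openConn u y : Set (BondConfig V)) ∪ openConn v y) Set.univ Set.univ Set.univ ∅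
    (fun ω _ ha _ => iff_of_true (Or.inl (mem_openConn_of_mem hyu.symm ha)) (Set.mem_univ _))
    (fun ω _ _ ha => iff_of_true (Or.inl (mem_openConn_of_mem hyu.symm ha)) (Set.mem_univ _))
    (fun ω _ _ hb => iff_of_true (Or.inr (mem_openConn_of_mem' hyv.symm hb)) (Set.mem_univ _))
    (fun ω hω ha hb => by
      rw [Set.mem_union, mem_openConn_iff', mem_openConn_iff', reachable_ux_apex_iff hyu hyv (apex_ae w hyu hyv hw hω),
        reachable_vx_apex_iff hyu hyv (apex_ae w hyu hyv hw hω)]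
      constructor
      · rintro ((h | h) | (h | h))
        · exact absurd h ha
        · exact absurd h.1 hb
        · exact absurd h hb
        · exact absurd h.1 ha
      · exact fun h => absurd h (Set.notMem_empty ω))
    (univ_insens _) (univ_insens _) (univ_insens _) (univ_insens _)
  rw [Set.univ_inter, sum_rcWeightW_ind_empty] at h
  linear_combination h

include hyu hyv huv hw hq in
/-- `S_w((u ↔ y ∨ v ↔ y) ∧ u ↮ v)`: table `(∅, K'ᶜ, K'ᶜ, ∅)`. [cite: Grimmett2006, Thm. (3.1)(a) (p. 37); §1.4 eq. (1.20) (p. 15)] -/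
theorem apexForm_att_sep :
    ∑ ω : BondConfig V, rcWeightW w q ∅ ω * ind (((openConn u y : Set (BondConfig V)) ∪ openConn v y) ∩ (openConn u v)ᶜ) ω =
      ((w s(u, y) : unitInterval) : ℝ) * (1 - ((w s(y, v) : unitInterval) : ℝ)) * q⁻¹ * ∑ ω : BondConfig V, rcWeightW (Function.update (Function.update w s(u, y) 0) s(y, v) 0) q ∅ ω * ind {ω : BondConfig V | ω \ {s(u, y), s(y, v)} ∈ (openConn u v : Set (BondConfig V))}ᶜ ω +
        (1 - ((w s(u, y) : unitInterval) : ℝ)) * ((w s(y, v) : unitInterval) : ℝ) * q⁻¹ * ∑ ω : BondConfig V, rcWeightW (Function.update (Function.update w s(u, y) 0) s(y, v) 0) q ∅ ω * ind {ω : BondConfig V | ω \ {s(u, y), s(y, v)} ∈ (openConn u v : Set (BondConfig V))}ᶜ ω := by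
  have h := apex_mass_table w hq hyu hyv huv hw (((openConn u y : Set (BondConfig V)) ∪ openConn v y) ∩ (openConn u v)ᶜ) ∅ {ω : BondConfig V | ω \ {s(u, y), s(y, v)} ∈ (openConn u v : Set (BondConfig V))}ᶜ {ω : BondConfig V | ω \ {s(u, y), s(y, v)} ∈ (openConn u v : Set (BondConfig V))}ᶜ ∅
    (fun ω _ ha hb => by
      constructor
      · rintro ⟨-, hc⟩; exact absurd (path_uv hyu hyv ha hb) hc
      · exact fun h => absurd h (Set.notMem_empty ω))
    (fun ω hω hb ha => by
      rw [Set.mem_inter_iff, Set.mem_compl_iff, Set.mem_compl_iff, Set.mem_setOf_eq, mem_openConn_iff' u v,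
        mem_openConn_iff' u v, reachable_uv_apex_iff hyu hyv (apex_ae w hyu hyv hw hω)]
      constructor
      · rintro ⟨-, hc⟩; exact fun h => hc (Or.inl h)
      · intro hc; exact ⟨Or.inl (mem_openConn_of_mem hyu.symm ha), fun h => h.elim hc fun h' => hb h'.2⟩)
    (fun ω hω ha hb => by
      rw [Set.mem_inter_iff, Set.mem_compl_iff, Set.mem_compl_iff, Set.mem_setOf_eq, mem_openConn_iff' u v,
        mem_openConn_iff' u v, reachable_uv_apex_iff hyu hyv (apex_ae w hyu hyv hw hω)]
      constructor
      · rintro ⟨-, hc⟩; exact fun h => hc (Or.inl h)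
      · intro hc; exact ⟨Or.inr (mem_openConn_of_mem' hyv.symm hb), fun h => h.elim hc fun h' => ha h'.1⟩)
    (fun ω hω ha hb => by
      rw [Set.mem_inter_iff, Set.mem_union, mem_openConn_iff' u y, mem_openConn_iff' v y,
        reachable_ux_apex_iff hyu hyv (apex_ae w hyu hyv hw hω), reachable_vx_apex_iff hyu hyv (apex_ae w hyu hyv hw hω)]
      constructor
      · rintro ⟨(h | h) | (h | h), -⟩
        · exact absurd h ha
        · exact absurd h.1 hb
        · exact absurd h hb
        · exact absurd h.1 ha
      · exact fun h => absurd h (Set.notMem_empty ω))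
    (empty_insens _) (empty_insens _) (apexAvoid_compl_insens u v y (Or.inl rfl)) (apexAvoid_compl_insens u v y (Or.inr rfl))
  rw [Set.empty_inter, sum_rcWeightW_ind_empty] at h
  linear_combination h

include hyu hyv huv hw hq in
/-- `S_w(u ↔ v ∧ v ↔ y)`: table `(univ, K', K', ∅)`. [cite: Grimmett2006, Thm. (3.1)(a) (p. 37); §1.4 eq. (1.20) (p. 15)] -/
theorem apexForm_uv_vy :
    ∑ ω : BondConfig V, rcWeightW w q ∅ ω * ind ((openConn u v : Set (BondConfig V)) ∩ openConn v y) ω =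
      ((w s(u, y) : unitInterval) : ℝ) * ((w s(y, v) : unitInterval) : ℝ) * q⁻¹ * (∑ ω : BondConfig V, rcWeightW (Function.update (Function.update w s(u, y) 0) s(y, v) 0) q ∅ ω * ind Set.univ ω + (q⁻¹ - 1) * ∑ ω : BondConfig V, rcWeightW (Function.update (Function.update w s(u, y) 0) s(y, v) 0) q ∅ ω * ind {ω : BondConfig V | ω \ {s(u, y), s(y, v)} ∈ (openConn u v : Set (BondConfig V))}ᶜ ω) +
        ((w s(u, y) : unitInterval) : ℝ) * (1 - ((w s(y, v) : unitInterval) : ℝ)) * q⁻¹ * ∑ ω : BondConfig V, rcWeightW (Function.update (Function.update w s(u, y) 0) s(y, v) 0) q ∅ ω * ind {ω : BondConfig V | ω \ {s(u, y), s(y, v)} ∈ (openConn u v : Set (BondConfig V))} ω +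
        (1 - ((w s(u, y) : unitInterval) : ℝ)) * ((w s(y, v) : unitInterval) : ℝ) * q⁻¹ * ∑ ω : BondConfig V, rcWeightW (Function.update (Function.update w s(u, y) 0) s(y, v) 0) q ∅ ω * ind {ω : BondConfig V | ω \ {s(u, y), s(y, v)} ∈ (openConn u v : Set (BondConfig V))} ω := by
  have h := apex_mass_table w hq hyu hyv huv hw ((openConn u v : Set (BondConfig V)) ∩ openConn v y) Set.univ {ω : BondConfig V | ω \ {s(u, y), s(y, v)} ∈ (openConn u v : Set (BondConfig V))} {ω : BondConfig V | ω \ {s(u, y), s(y, v)} ∈ (openConn u v : Set (BondConfig V))} ∅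
    (fun ω _ ha hb => iff_of_true ⟨path_uv hyu hyv ha hb, mem_openConn_of_mem' hyv.symm hb⟩ (Set.mem_univ _))
    (fun ω hω hb ha => by
      rw [Set.mem_inter_iff, mem_openConn_iff' u v, mem_openConn_iff' v y, reachable_uv_apex_iff hyu hyv (apex_ae w hyu hyv hw hω),
        reachable_vx_apex_iff hyu hyv (apex_ae w hyu hyv hw hω), Set.mem_setOf_eq, mem_openConn_iff']
      constructor
      · rintro ⟨h, -⟩; exact h.elim id fun h' => absurd h'.2 hb
      · intro h; exact ⟨Or.inl h, Or.inr ⟨ha, h⟩⟩)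
    (fun ω hω ha hb => by
      rw [Set.mem_inter_iff, mem_openConn_iff' u v, reachable_uv_apex_iff hyu hyv (apex_ae w hyu hyv hw hω), Set.mem_setOf_eq, mem_openConn_iff']
      constructor
      · rintro ⟨h, -⟩; exact h.elim id fun h' => absurd h'.1 ha
      · intro h; exact ⟨Or.inl h, mem_openConn_of_mem' hyv.symm hb⟩)
    (fun ω hω ha hb => by
      rw [Set.mem_inter_iff, mem_openConn_iff' v y, reachable_vx_apex_iff hyu hyv (apex_ae w hyu hyv hw hω)]
      constructor
      · rintro ⟨-, h⟩; exact h.elim (fun h' => absurd h' hb) fun h' => absurd h'.1 ha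
      · exact fun h => absurd h (Set.notMem_empty ω))
    (univ_insens _) (univ_insens _) (apexAvoid_insens u v y (Or.inl rfl)) (apexAvoid_insens u v y (Or.inr rfl))
  rw [Set.univ_inter, sum_rcWeightW_ind_empty] at h
  linear_combination h

include hyu hyv huv hw hq in
/-- `S_w(u ↔ v ∧ u ↔ y)`: table `(univ, K', K', ∅)`. [cite: Grimmett2006, Thm. (3.1)(a) (p. 37); §1.4 eq. (1.20) (p. 15)] -/
theorem apexForm_uv_uy :
    ∑ ω : BondConfig V, rcWeightW w q ∅ ω * ind ((openConn u v : Set (BondConfig V)) ∩ openConn u y) ω =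
      ((w s(u, y) : unitInterval) : ℝ) * ((w s(y, v) : unitInterval) : ℝ) * q⁻¹ * (∑ ω : BondConfig V, rcWeightW (Function.update (Function.update w s(u, y) 0) s(y, v) 0) q ∅ ω * ind Set.univ ω + (q⁻¹ - 1) * ∑ ω : BondConfig V, rcWeightW (Function.update (Function.update w s(u, y) 0) s(y, v) 0) q ∅ ω * ind {ω : BondConfig V | ω \ {s(u, y), s(y, v)} ∈ (openConn u v : Set (BondConfig V))}ᶜ ω) +
        ((w s(u, y) : unitInterval) : ℝ) * (1 - ((w s(y, v) : unitInterval) : ℝ)) * q⁻¹ * ∑ ω : BondConfig V, rcWeightW (Function.update (Function.update w s(u, y) 0) s(y, v) 0) q ∅ ω * ind {ω : BondConfig V | ω \ {s(u, y), s(y, v)} ∈ (openConn u v : Set (BondConfig V))} ω +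
        (1 - ((w s(u, y) : unitInterval) : ℝ)) * ((w s(y, v) : unitInterval) : ℝ) * q⁻¹ * ∑ ω : BondConfig V, rcWeightW (Function.update (Function.update w s(u, y) 0) s(y, v) 0) q ∅ ω * ind {ω : BondConfig V | ω \ {s(u, y), s(y, v)} ∈ (openConn u v : Set (BondConfig V))} ω := by
  have h := apex_mass_table w hq hyu hyv huv hw ((openConn u v : Set (BondConfig V)) ∩ openConn u y) Set.univ {ω : BondConfig V | ω \ {s(u, y), s(y, v)} ∈ (openConn u v : Set (BondConfig V))} {ω : BondConfig V | ω \ {s(u, y), s(y, v)} ∈ (openConn u v : Set (BondConfig V))} ∅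
    (fun ω _ ha hb => iff_of_true ⟨path_uv hyu hyv ha hb, mem_openConn_of_mem hyu.symm ha⟩ (Set.mem_univ _))
    (fun ω hω hb ha => by
      rw [Set.mem_inter_iff, mem_openConn_iff' u v, reachable_uv_apex_iff hyu hyv (apex_ae w hyu hyv hw hω), Set.mem_setOf_eq, mem_openConn_iff']
      constructor
      · rintro ⟨h, -⟩; exact h.elim id fun h' => absurd h'.2 hb
      · intro h; exact ⟨Or.inl h, mem_openConn_of_mem hyu.symm ha⟩)
    (fun ω hω ha hb => by
      rw [Set.mem_inter_iff, mem_openConn_iff' u v, mem_openConn_iff' u y, reachable_uv_apex_iff hyu hyv (apex_ae w hyu hyv hw hω),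
        reachable_ux_apex_iff hyu hyv (apex_ae w hyu hyv hw hω), Set.mem_setOf_eq, mem_openConn_iff']
      constructor
      · rintro ⟨h, -⟩; exact h.elim id fun h' => absurd h'.1 ha
      · intro h; exact ⟨Or.inl h, Or.inr ⟨hb, h⟩⟩)
    (fun ω hω ha hb => by
      rw [Set.mem_inter_iff, mem_openConn_iff' u y, reachable_ux_apex_iff hyu hyv (apex_ae w hyu hyv hw hω)]
      constructor
      · rintro ⟨-, h⟩; exact h.elim (fun h' => absurd h' ha) fun h' => absurd h'.1 hb
      · exact fun h => absurd h (Set.notMem_empty ω))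
    (univ_insens _) (univ_insens _) (apexAvoid_insens u v y (Or.inl rfl)) (apexAvoid_insens u v y (Or.inr rfl))
  rw [Set.univ_inter, sum_rcWeightW_ind_empty] at h
  linear_combination h

end Forms

end FK

end Summit.CriticalPhenomena.PercolationContinuityZ3.Theorems

end
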